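import Summits.QuantumAdvantage.QuantumAdvantage.Theorems.CubicForrelationNearExactIsExactSixteenSplitCapacity
import Summits.QuantumAdvantage.QuantumAdvantage.Theorems.CubicForrelationNearExactIsExactIsolationSmallN
import Summits.QuantumAdvantage.QuantumAdvantage.Theorems.NearExactIsExact.Negative.FifteenSixteenths

/-!
# Crux `CubicForrelation.NearExactIsExact` (stmt-QuantumAdvantage-14043) — isolation at `31/32` on 16 bits:
  `θ₁₆ ∈ [15/16, 31/32]`

Certificate seat `b2b-cforr-cert` (gen 3, 2026-08-19).  HONEST FRAMING: the value here is a DECIDABLE VERDICT about the finite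
slice `n = 16` of the crux — a kernel-checked THEOREM — NOT summit progress (the crux asks for ONE `θ < 1` uniform in `n`;
nothing here bears on that beyond the known `θ ≥ 15/16`).

THEOREM `isolation_sixteen_31_32`: **for all cubic `f, g : 𝔽₂¹⁶ → 𝔽₂`, `Φ(f,g) > 31/32 ⇒ Φ(f,g) = 1`.**  The tree had `63/64`
(`isolation_sixteen`, the 2-adic Walsh tower); with the landed structural value `Φ(f16,g16) = 15/16`
(`Negative/FifteenSixteenths.lean`) the least isolating constant on 16 bits now satisfies `θ₁₆ ∈ [15/16, 31/32]`
(`theta_sixteen_bounds_31_32`; the window `(15/16, 31/32]` remains OPEN).  For comparison: Maiorana–McFarland-shaped cubic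
pairs are capped at exactly `31/32` for every `n` (`ar_rankTwoCeiling`, the disprover's MM-GAP analysis), so `31/32` is the
first constant at which the finite slices meet the structural ceiling of the known families.

Proof.  ONE-SIDED: it is a statement about the Walsh CAPACITY `Σ_x |W_g(x)|` of a single cubic `g` (`Φ(f,g)·2²⁴ ≤ Σ|W_g|` for
every `f`).  Write `W_g = 64u` (Ax).  If some `u(x)` is odd, `Σ|W_g| ≤ (31/32)·2²⁴` by `sx_capacity_31_32`
(`…SixteenSplitCapacity`: Parseval + one pointwise inequality + the mixed digits of `…SixteenDigits` + the Reed–Muller bound,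
the residual configuration being excluded by the saturated-tiling parity argument of `…SixteenResidual`).  If every `u(x)` is
even, the landed tower continues (`tw_step` at level `7`: cost `31/32`; `tw_top` at the bent level `8`: bent or cost `31/32`;
`tw_bent_end`: a bent cubic has a dual of degree `≤ 5`, so `Φ = 1 ∨ Φ ≤ 15/16`).

References: J. Ax (1964) / R. J. McEliece (1972) (Carlet 2021 §4.1); O. S. Rothaus, JCTA 20 (1976); X.-D. Hou, Discrete Math.
189 (1998); C. Carlet, *Boolean Functions for Cryptography and Coding Theory*, CUP 2021; S. Aaronson, A. Ambainis,
*Forrelation*, SIAM J. Comput. 47 (2018) §1.1.1.  Everything below is proved from Mathlib and the tree; axioms are the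
standard three (no `native_decide` anywhere in this file's closure).
-/

set_option linter.dupNamespace false -- D-0017: single-problem summit ⇒ `QuantumAdvantage.QuantumAdvantage` by design

noncomputable section

namespace Summit.QuantumAdvantage.QuantumAdvantage.Theorems.CubicForrelation.NearExactIsExact

open Finset
open Literature.Computability.QuantumComplexity
open Literature.Computability.QuantumComplexity.DerivativeWalsh (W)
open Summit.QuantumAdvantage.QuantumAdvantage.Theorems.NearExactIsExact.Negative
  (f16 g16 isDegLeFun_f16 isDegLeFun_g16 forrelation_f16_g16)

/-- **Isolation at `31/32` on 16 bits.** For all cubic `f, g : 𝔽₂¹⁶ → 𝔽₂`: `Φ(f,g) > 31/32 ⇒ Φ(f,g) = 1` (the tree had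
`63/64`, `isolation_sixteen`).  Level 6 with a non-zero parity: capacity `≤ 31/32` (`sx_capacity_31_32`); level 7: cost
`31/32`; level 8: bent (dual of degree `≤ 5`, `Φ = 1 ∨ Φ ≤ 15/16`) or cost `31/32`. [this work] -/
theorem isolation_sixteen_31_32 :
    ∀ f g : (Fin (8 + 8) → Bool) → Bool, IsDegLeFun 3 f → IsDegLeFun 3 g →
      31 / 32 < forrelation f g → forrelation f g = 1 := by
  intro f g hf hg hΦ
  obtain ⟨u₆, hu₆⟩ := tw_base g hg 6 (by norm_num)
  by_cases hodd : ∃ x, Odd (u₆ x)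
  · exfalso
    have := tw_forrelation_le_of_cap f g (sx_capacity_31_32 g u₆ hg hu₆ hodd)
    linarith
  · push Not at hodd
    have hu₇ := tw_level_up g u₆ hu₆ hodd
    rcases tw_step (j := 7) (d := 2) g (fun x => u₆ x / 2) hg (by norm_num) hu₇ (by intro k hk hkn; omega)
      with hcap | ⟨u₈, hu₈⟩
    · exfalso; have := tw_forrelation_le_of_cap f g hcap; norm_num at this; linarith
    rcases tw_top (d := 4) g u₈ hg hu₈ (by intro k hk hkn; omega) with hbent | hcap
    · rcases tw_bent_end (by norm_num) f g hf hg hbent with h | h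
      · exact h
      · exfalso; norm_num at h; linarith
    · exfalso; have := tw_forrelation_le_of_cap f g hcap; norm_num at this; linarith

/-- **No cubic pair on 16 bits has `Φ ∈ (31/32, 1)`.** [this work] -/
theorem no_window_sixteen_31_32 :
    ¬ ∃ f g : (Fin (8 + 8) → Bool) → Bool, IsDegLeFun 3 f ∧ IsDegLeFun 3 g ∧
      31 / 32 < forrelation f g ∧ forrelation f g < 1 := by
  rintro ⟨f, g, hf, hg, hlo, hhi⟩
  exact absurd (isolation_sixteen_31_32 f g hf hg hlo) (ne_of_lt hhi)

/-- The `n = 16` slice of `NearExactIsExact` fails only through values `≤ 31/32`: restricted to 16 bits the crux HOLDS with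
`θ = 31/32` (and fails with every `θ < 15/16`, `Negative.forrelation_f16_g16`). [this work] -/
theorem nearExact_slice_sixteen_31_32 :
    ∀ f g : (Fin (8 + 8) → Bool) → Bool, IsDegLeFun 3 f → IsDegLeFun 3 g →
      forrelation f g ≠ 1 → forrelation f g ≤ 31 / 32 := by
  intro f g hf hg hne
  by_contra hlt
  push Not at hlt
  exact hne (isolation_sixteen_31_32 f g hf hg hlt)

/-- **`θ₁₆ ∈ [15/16, 31/32]`** — the `n = 16` row of the certified `θ_n` ladder (`…ThetaLadder.lean` had `[15/16, 63/64]`), as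
ONE theorem at the literal type `Fin 16`: on 16 bits isolation of exactness for cubic pairs holds above `31/32`
(`isolation_sixteen_31_32`), and no `θ < 15/16` isolates (the biquadratic Maiorana–McFarland pair of
`Negative/FifteenSixteenths.lean` has `Φ = 15/16 ≠ 1`, structural).  The window `(15/16, 31/32]` is NOT decided by the tree.
Finite-slice verdict; NOT summit progress. [this work] -/
theorem theta_sixteen_bounds_31_32 :
    (∀ f g : (Fin 16 → Bool) → Bool, IsDegLeFun 3 f → IsDegLeFun 3 g →
        (31 / 32 : ℝ) < forrelation f g → forrelation f g = 1) ∧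
    ∀ θ : ℝ, (∀ f g : (Fin 16 → Bool) → Bool, IsDegLeFun 3 f → IsDegLeFun 3 g →
        θ < forrelation f g → forrelation f g = 1) → 15 / 16 ≤ θ := by
  refine ⟨fun f g hf hg h => isolation_sixteen_31_32 f g hf hg h, fun θ hθ => ?_⟩
  by_contra hlt
  have h1 := hθ f16 g16 isDegLeFun_f16 isDegLeFun_g16 (by rw [forrelation_f16_g16]; linarith)
  rw [forrelation_f16_g16] at h1
  norm_num at h1

end Summit.QuantumAdvantage.QuantumAdvantage.Theorems.CubicForrelation.NearExactIsExact

end
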